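/-
Copyright: b2b-lace packet (CARVER gen 53).  [FvdH17] App. B row `(Ā^ι)_{0,2}` AS TYPED in the tree (the
NON-repulsive star `T^*_{1,1̲,0}` of the display (B.5c)): an elementary LOWER bound `2d·p² ≤ (Ā^ι)_{0,2}` at
`Letters.perc d p`, from the bond-reversal configuration that the star admits and the repulsive triangle of
§6.1 "Case a = 0, b ≥ 2" excludes.  Proofs only; no named fact; no numeral; no dimension.
-/
import Literature.Probability.FitznerVanDerHofstad2017.NobleElementsClosedForms
import Literature.Probability.FitznerVanDerHofstad2017.NobleBoundsN1Cls22
import Literature.Probability.FitznerVanDerHofstad2017.NonRepulsiveDiagramBounds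
import Literature.Probability.FitznerVanDerHofstad2017.NobleRemainderBound
import Literature.Probability.FitznerVanDerHofstad2017.UnitVectorPairSums
import HarnessLib

/-!
# [FvdH17] App. B: the entry `(Ā^ι)_{0,2}` as typed — a lower bound from the bond-reversal configuration

Reproduction module (build `lace`, LEAN-IN-TREE RULE) in the package of
R. Fitzner, R. van der Hofstad, *Mean-field behavior for nearest-neighbor percolation in `d > 10`*,
Electron. J. Probab. **22** (2017) no. 43 [FvdH17] (arXiv:1506.07977v2): App. B Table "definition of
`Ā^{ι,a,b}(0,v,x,y)`", row `(0,2)` (p. 78): `Ā^{ι,0,2}(0,v,x,y) = δ_{0,v} T^*_{1,1̲,0}(−y, e_ι−y, x−y)` with the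
NON-repulsive triangle `T^*` of (4.8) (p. 34) — the form the tree's `NobleBlocks.blockAbar₀` types; §6.1
"Case a = 0, b ≥ 2" (p. 59) derives the same element with the REPULSIVE `𝓣_{1,1̲,0}` (as does the thesis
[Fit13] (4.5.18), p. 206).

The tree's closed form (`NobleElementsClosedForms.matAbarIota_zero_two`) is
`(Ā^ι)_{0,2} = sup_y Σ_x Σ_κ T^*_{1,1̲,0}(−(x+y), e_κ−(x+y), −y)` with
`T^*_{j₁,j₂,j₃}(x₁,x₂,x₃) = τ_{j₁}(x₁) τ_{j₂}(x₂−x₁) τ_{j₃}(x₃−x₂)`.  At the out-gap `y = 0` and `x = e_κ` the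
summand is `τ_{≥1}(−e_κ) · τ_{1̲}(e_κ) · τ_{≥0}(0)`: the marked bond `e_κ` RETRACES the first line (a
configuration of bond re-use, impossible for the repulsive triangle).  At `Letters.perc d p`:
`τ_{1̲}(±e_κ) = p` (`perc_tau_eq_one_stepVec`), `τ_{≥1} ≥ τ_{1̲}` (`perc_tau_le_floor`), `τ_{≥0}(0) = 1`, whence

* `perc_Tst_reversal_ge` — each of the `2d` reversal summands is `≥ p²`;
* **`perc_matAbarIota_zero_two_ge`** — `ofReal (2d p²) ≤ matAbarIota (Letters.perc d p) 0 2` (any `d`, any `p`).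
* `perc_matAbarIotaSt_zero_two_ge` — the same for the starred matrix entry `matAbarIotaSt (Letters.perc d p) 0 2`
  (`matAbarIotaSt_zero_two`: row `b ≥ 2` of `Ā^{ι,a,b,*}` is the same `T*`, §5.1 Table p. 47).

The module records only these inequalities (any `d`, any `p ∈ [0,1]`); what they mean for the programme's
numerical tables is discussed outside the tree.  Nothing is evaluated here; no named fact; no dimension; all
theorems kernel-checked modulo the standard axioms.

[cite: FitznerVanDerHofstad2017, App. B Table Ā^{ι,a,b} row (0,2) (arXiv:1506.07977v2 p. 78); §4.2 (4.1), (4.8) (p. 34); §6.1 "Case a = 0, b ≥ 2" (p. 59); §5.1 (5.1) (p. 46)]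
-/

noncomputable section

namespace Literature.Probability.FitznerVanDerHofstad2017

open MeasureTheory Finset
open scoped BigOperators ENNReal
open Literature.Probability.LatticeModels Literature.Probability.Percolation
open Literature.Probability.FitznerVanDerHofstad2017.NobleBlocks
open Literature.Probability.FitznerVanDerHofstad2017.NobleBlocks.LenIdx
open Literature.Probability.FitznerVanDerHofstad2017.UnitVectorPairs (opp card_unitVec)

variable {d : ℕ}

/-- The opposite unit step: `e_{opp κ} = −e_κ`. [folklore] -/
private theorem stepVec_opp (κ : Fin d × Bool) : (Percolation.stepVec (opp κ) : Site d) = -Percolation.stepVec κ := by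
  obtain ⟨i, b⟩ := κ
  cases b <;> simp [Percolation.stepVec, opp]

/-- `τ_{≥0}(0) = 1` at `Letters.perc d p` (`{0 ←0→ 0} = {0 ↔ 0}`). [cite: FitznerVanDerHofstad2017, §4.2 (4.1) (arXiv:1506.07977v2 p. 34)] -/
theorem perc_tau_ge_zero_zero (p : unitInterval) : (Letters.perc d p).tau (ge 0) (0 : Site d) = 1 := by
  rw [perc_tau_ge, tauGe_zero_eq_tau, tau_self, ENNReal.ofReal_one]

/-- `p ≤ τ_{≥1}(−e_κ)` at `Letters.perc d p` (`τ_{≥1} ≥ τ_{1̲}` and `τ_{1̲}(−e_κ) = τ_{1̲}(e_{opp κ}) = p`).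
[cite: FitznerVanDerHofstad2017, §4.2 (4.1) (arXiv:1506.07977v2 p. 34)] -/
theorem perc_ofReal_le_tau_ge_one_neg_stepVec (p : unitInterval) (κ : Fin d × Bool) :
    ENNReal.ofReal p ≤ (Letters.perc d p).tau (ge 1) (-(Percolation.stepVec κ) : Site d) := by
  rw [← stepVec_opp, ← perc_tau_eq_one_stepVec p (opp κ)]
  exact perc_tau_le_floor (p := p) (eq 1) _

/-- **The reversal summand**: at out-gap `y = 0` and `x = e_κ` the `(0,2)` summand of `(Ā^ι)_{0,2}` as typed,
`T^*_{1,1̲,0}(−e_κ, e_κ − e_κ, 0) = τ_{≥1}(−e_κ) τ_{1̲}(e_κ) τ_{≥0}(0)`, is at least `p · p` at `Letters.perc d p`.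
[cite: FitznerVanDerHofstad2017, App. B Table Ā^{ι,a,b} row (0,2) (arXiv:1506.07977v2 p. 78); §4.2 (4.8) (p. 34)] -/
theorem perc_Tst_reversal_ge (p : unitInterval) (κ : Fin d × Bool) :
    ENNReal.ofReal p * ENNReal.ofReal p ≤
      (Letters.perc d p).Tst (ge 1) (eq 1) (ge 0) (-(Percolation.stepVec κ)) (Percolation.stepVec κ - Percolation.stepVec κ) (0 : Site d) := by
  simp only [Letters.Tst, Letters.Bst, sub_self, zero_sub, neg_neg]
  rw [perc_tau_eq_one_stepVec, perc_tau_ge_zero_zero, mul_one]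
  gcongr
  exact perc_ofReal_le_tau_ge_one_neg_stepVec p κ

/-- **`2d · p² ≤ (Ā^ι)_{0,2}` as typed** at `Letters.perc d p`: the closed form `matAbarIota_zero_two`, the
out-gap `y = 0`, the `2d` lattice points `x = e_κ` (`stepVec_injective'`), the diagonal `κ' = κ` of the inner
unit-vector sum, and `perc_Tst_reversal_ge`.  Any `d`, any `p ∈ [0,1]`; nothing evaluated.
[cite: FitznerVanDerHofstad2017, App. B Table Ā^{ι,a,b} row (0,2) (arXiv:1506.07977v2 p. 78); §5.1 (5.1) (p. 46); §6.1 "Case a = 0, b ≥ 2" (p. 59)] -/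
theorem perc_matAbarIota_zero_two_ge (p : unitInterval) :
    ENNReal.ofReal (2 * d * (p : ℝ) ^ 2) ≤ matAbarIota (Letters.perc d p) 0 2 := by
  classical
  set L := Letters.perc d p with hL
  rw [matAbarIota_zero_two]
  refine le_trans ?_ (le_iSup _ (0 : Site d))
  simp only [add_zero, neg_zero]
  have hconst : ENNReal.ofReal (2 * d * (p : ℝ) ^ 2) =
      ∑ _κ : Fin d × Bool, ENNReal.ofReal p * ENNReal.ofReal p := by
    rw [Finset.sum_const, Finset.card_univ, card_unitVec, nsmul_eq_mul, ← ENNReal.ofReal_mul p.2.1,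
      ← ENNReal.ofReal_natCast, ← ENNReal.ofReal_mul (by positivity)]
    congr 1
    push_cast
    ring
  rw [hconst]
  calc ∑ _κ : Fin d × Bool, ENNReal.ofReal p * ENNReal.ofReal p
      ≤ ∑ κ : Fin d × Bool, L.Tst (ge 1) (eq 1) (ge 0) (-(Percolation.stepVec κ)) (Percolation.stepVec κ - Percolation.stepVec κ) 0 :=
        Finset.sum_le_sum fun κ _ => perc_Tst_reversal_ge p κ
    _ ≤ ∑ κ : Fin d × Bool, ∑ κ' : Fin d × Bool, L.Tst (ge 1) (eq 1) (ge 0) (-(Percolation.stepVec κ)) (Percolation.stepVec κ' - Percolation.stepVec κ) 0 :=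
        Finset.sum_le_sum fun κ _ =>
          Finset.single_le_sum (f := fun κ' => L.Tst (ge 1) (eq 1) (ge 0) (-(Percolation.stepVec κ)) (Percolation.stepVec κ' - Percolation.stepVec κ) 0)
            (fun _ _ => (zero_le : (0 : ℝ≥0∞) ≤ _)) (Finset.mem_univ κ)
    _ = ∑ x ∈ (Finset.univ : Finset (Fin d × Bool)).image Percolation.stepVec,
          ∑ κ' : Fin d × Bool, L.Tst (ge 1) (eq 1) (ge 0) (-x) (Percolation.stepVec κ' - x) 0 := by
        rw [Finset.sum_image fun a _ b _ h => stepVec_injective' h]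
    _ ≤ ∑' x, ∑ κ' : Fin d × Bool, L.Tst (ge 1) (eq 1) (ge 0) (-x) (Percolation.stepVec κ' - x) 0 := ENNReal.sum_le_tsum _

/-- **The same lower bound for the starred matrix entry `(Ā^{ι,*})_{0,2}`** (row `b ≥ 2` of `Ā^{ι,a,b,*}` is the
same non-repulsive `T*`, `matAbarIotaSt_zero_two`): `ofReal (2d p²) ≤ matAbarIotaSt (Letters.perc d p) 0 2`.
[cite: FitznerVanDerHofstad2017, §5.1 Table "Ā^{ι,a,b,*}" (arXiv:1506.07977v2 p. 47); App. B Table Ā^{ι,a,b} row (0,2) (p. 78)] -/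
theorem perc_matAbarIotaSt_zero_two_ge (p : unitInterval) :
    ENNReal.ofReal (2 * d * (p : ℝ) ^ 2) ≤ matAbarIotaSt (Letters.perc d p) 0 2 := by
  rw [matAbarIotaSt_zero_two, ← matAbarIota_zero_two]
  exact perc_matAbarIota_zero_two_ge p

end Literature.Probability.FitznerVanDerHofstad2017
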